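import Mathlib
import Summits.Ventures.PercRepro2.RowC1E1Avoid

/-!
# The `b`-avoiding cluster `K = C_{G−b}(a₂)`: combinatorics of `Q ∩ {b ∈ C₂}` and of `Q`
(blind cell PercRepro2, p2 g29; proofs/P2-G29-E1.md §2, Lemma 1, part 1 of 3)

`K` is the cluster of `a₂` in the configuration with every edge at `b` closed (`delConfig ends {b}`).
For `a₂ ≠ b`:

* `exists_openAdj_of_conn` (last exit from `b`): an open path `a₂ → b` ends with an open edge
  `w — b` with `w ∈ K`;
* `not_conn_of_not_conn_delConfig`: if `a₁ ∉ K` and `b ↮ a₁` in `G − K`, then `a₁ ↮ a₂` (every open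
  path from `a₁` into `K` enters `K` through `b`);
* **`bH_Q_iff`**: `b ↔ a₂ ∧ a₁ ↮ a₂` ⟺ `a₁ ∉ K` ∧ some edge from `b` into `K` is open ∧
  `b ↮ a₁` in `G − K`;
* **`Q_iff`**: `a₁ ↮ a₂` ⟺ `a₁ ∉ K` ∧ (no edge from `b` into `K` is open ∨ `b ↮ a₁` in `G − K`).

These are the pointwise domain-Markov identities behind the tower identities of
`RowC1AvoidTower.lean` and the `b`-avoiding attraction of `RowC1AvoidAttract.lean`.
-/

namespace Summit.Ventures.PercRepro2

namespace RowC1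

section Comb

variable {V : Type*} {E : Type*} {ends : E → Sym2 V}

/-- Closing the edges at `W` only closes edges. -/
lemma delConfig_le (W : Set V) (ω : Config E) : delConfig ends W ω ≤ ω := by
  intro e
  by_cases h : e ∈ touches ends W
  · rw [delConfig_apply_of_mem h]; exact Bool.false_le _
  · rw [delConfig_apply_of_notMem h]

/-- The vertices of `W` are isolated once every edge at `W` is closed. -/
lemma eq_of_conn_delConfig_of_mem {W : Set V} {ω : Config E} {x y : V} (hx : x ∈ W)
    (h : Conn ends (delConfig ends W ω) x y) : y = x := by
  have key : y ∈ ({x} : Set V) := by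
    refine mem_of_conn_of_closed (ends := ends) (ω := delConfig ends W ω) ?_ rfl h
    rintro z hz y' hzy
    rw [Set.mem_singleton_iff] at hz
    subst hz
    obtain ⟨_, e, he, hends⟩ := openGraph_adj.1 hzy
    have : e ∈ touches ends W := mem_touches_of_ends hends (Or.inl hx)
    rw [delConfig_apply_of_mem this] at he
    exact absurd he Bool.false_ne_true
  exact key

/-- **Last exit from `b`**: an open path from `a₂ ≠ b` to `b` ends with an open edge `w — b` whose
other endpoint `w` is joined to `a₂` avoiding `b`. -/
lemma exists_openAdj_of_conn {ω : Config E} {a₂ b : V} (hne : a₂ ≠ b) (h : Conn ends ω a₂ b) :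
    ∃ w, OpenAdj ends ω b w ∧ Conn ends (delConfig ends {b} ω) a₂ w := by
  by_contra hcon
  have hcon' : ∀ w, OpenAdj ends ω b w → ¬ Conn ends (delConfig ends {b} ω) a₂ w :=
    fun w h1 h2 => hcon ⟨w, h1, h2⟩
  -- the vertices reached from `a₂` avoiding `b` form a closed set not containing `b`
  have key : b ∈ {x | Conn ends (delConfig ends {b} ω) a₂ x} := by
    refine mem_of_conn_of_closed (ends := ends) (ω := ω) ?_ (conn_refl _ _ _) h
    rintro x hx y hxy
    obtain ⟨_, e, he, hends⟩ := openGraph_adj.1 hxy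
    by_cases hb : e ∈ touches ends {b}
    · obtain ⟨z, hz, z', hzz'⟩ := hb
      rw [Set.mem_singleton_iff] at hz
      rw [hz, hends] at hzz'
      rcases Sym2.eq_iff.1 hzz' with ⟨hxz, -⟩ | ⟨-, hyz⟩
      · -- `x = b`: impossible, `x` is reached avoiding `b` and `a₂ ≠ b`
        have hxb : Conn ends (delConfig ends {b} ω) a₂ b := hxz ▸ hx
        exact absurd (eq_of_conn_delConfig_of_mem (W := {b}) (x := b) rfl (conn_symm hxb)) hne
      · -- `y = b`: then `x` is a witness
        exact absurd hx (hcon' x ⟨e, he, by rw [hends, hyz, Sym2.eq_swap]⟩)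
    · refine conn_trans hx (conn_of_openAdj ⟨e, ?_, hends⟩)
      rw [delConfig_apply_of_notMem hb]; exact he
  exact hne (eq_of_conn_delConfig_of_mem (W := {b}) (x := b) rfl (conn_symm key))

/-- If `a₁ ∉ K` and `b ↮ a₁` in `G − K`, then `a₁ ↮ a₂` (`K = C_{G−b}(a₂)`): every open path from
`a₁` into `K` enters `K` through `b`. -/
lemma not_conn_of_not_conn_delConfig {ω : Config E} {a₁ a₂ b : V} (hne : a₂ ≠ b)
    (ha₁ : a₁ ∉ cluster ends (delConfig ends {b} ω) a₂)
    (hb : ¬ Conn ends (delConfig ends (cluster ends (delConfig ends {b} ω) a₂) ω) a₁ b) :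
    ¬ Conn ends ω a₁ a₂ := by
  intro h
  set K := cluster ends (delConfig ends {b} ω) a₂ with hK
  have hbK : b ∉ K := fun hbK => hne (eq_of_conn_delConfig_of_mem (W := {b}) rfl
    (conn_symm (show Conn ends (delConfig ends {b} ω) a₂ b from hbK)))
  have key : a₂ ∈ {x | Conn ends (delConfig ends K ω) a₁ x} := by
    refine mem_of_conn_of_closed (ends := ends) (ω := ω) ?_ (conn_refl _ _ _) h
    rintro x hx y hxy
    obtain ⟨_, e, he, hends⟩ := openGraph_adj.1 hxy
    have hxK : x ∉ K := fun hxK => ha₁ (by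
      have := eq_of_conn_delConfig_of_mem (W := K) hxK (conn_symm hx)
      rw [this]; exact hxK)
    by_cases hK' : e ∈ touches ends K
    · -- the edge enters `K` at `y`; it must be the edge at `b`
      obtain ⟨z, hz, z', hzz'⟩ := hK'
      rw [hends] at hzz'
      have hyK : y ∈ K := by
        rcases Sym2.eq_iff.1 hzz' with ⟨hxz, -⟩ | ⟨-, hyz⟩
        · exact absurd (hxz ▸ hz) hxK
        · exact hyz ▸ hz
      by_cases hbe : e ∈ touches ends {b}
      · obtain ⟨z₁, hz₁, z₁', hz₁'⟩ := hbe
        rw [Set.mem_singleton_iff] at hz₁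
        subst hz₁
        rw [hends] at hz₁'
        rcases Sym2.eq_iff.1 hz₁' with ⟨hxb, -⟩ | ⟨-, hyb⟩
        · exact absurd (hxb ▸ hx) hb
        · exact absurd (hyb ▸ hyK) hbK
      · -- the edge avoids `b`, so `x ∈ K`
        exfalso
        apply hxK
        have hopen : delConfig ends {b} ω e = true := by
          rw [delConfig_apply_of_notMem hbe]; exact he
        exact conn_trans hyK (conn_of_openAdj ⟨e, hopen, by rw [hends, Sym2.eq_swap]⟩)
    · refine conn_trans hx (conn_of_openAdj ⟨e, ?_, hends⟩)
      rw [delConfig_apply_of_notMem hK']; exact he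
  have ha₂K : a₂ ∈ K := mem_cluster_self _ _ _
  have := eq_of_conn_delConfig_of_mem (W := K) ha₂K (conn_symm key)
  exact ha₁ (this ▸ ha₂K)

/-- **`Q ∩ {b ∈ C₂}` through the `b`-avoiding cluster**: for `a₂ ≠ b`,
`b ↔ a₂ ∧ a₁ ↮ a₂` iff `a₁ ∉ K`, some edge from `b` into `K` is open, and `b ↮ a₁` in `G − K`. -/
lemma bH_Q_iff {ω : Config E} {a₁ a₂ b : V} (hne : a₂ ≠ b) :
    (Conn ends ω a₂ b ∧ ¬ Conn ends ω a₁ a₂) ↔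
      (a₁ ∉ cluster ends (delConfig ends {b} ω) a₂ ∧
        (∃ w ∈ cluster ends (delConfig ends {b} ω) a₂, OpenAdj ends ω b w) ∧
        ¬ Conn ends (delConfig ends (cluster ends (delConfig ends {b} ω) a₂) ω) b a₁) := by
  constructor
  · rintro ⟨hb, hQ⟩
    refine ⟨?_, ?_, ?_⟩
    · intro ha₁
      exact hQ (conn_symm (conn_mono (delConfig_singleton_le ends b ω) ha₁))
    · obtain ⟨w, hw, hw'⟩ := exists_openAdj_of_conn hne hb
      exact ⟨w, hw', hw⟩
    · intro hc
      exact hQ (conn_symm (conn_trans hb (conn_mono (delConfig_le _ ω) hc)))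
  · rintro ⟨ha₁, ⟨w, hw, hbw⟩, hc⟩
    refine ⟨?_, not_conn_of_not_conn_delConfig hne ha₁ (fun h => hc (conn_symm h))⟩
    exact conn_trans (conn_mono (delConfig_singleton_le ends b ω) hw) (conn_symm (conn_of_openAdj hbw))

/-- **`Q` through the `b`-avoiding cluster**: for `a₂ ≠ b`, `a₁ ↮ a₂` iff `a₁ ∉ K` and (no edge
from `b` into `K` is open, or `b ↮ a₁` in `G − K`). -/
lemma Q_iff {ω : Config E} {a₁ a₂ b : V} (hne : a₂ ≠ b) :
    ¬ Conn ends ω a₁ a₂ ↔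
      (a₁ ∉ cluster ends (delConfig ends {b} ω) a₂ ∧
        (¬ (∃ w ∈ cluster ends (delConfig ends {b} ω) a₂, OpenAdj ends ω b w) ∨
          ¬ Conn ends (delConfig ends (cluster ends (delConfig ends {b} ω) a₂) ω) b a₁)) := by
  constructor
  · intro hQ
    refine ⟨fun ha₁ => hQ (conn_symm (conn_mono (delConfig_singleton_le ends b ω) ha₁)), ?_⟩
    by_contra hcon
    have hatt : ∃ w ∈ cluster ends (delConfig ends {b} ω) a₂, OpenAdj ends ω b w := by
      by_contra hno; exact hcon (Or.inl hno)
    have hc : Conn ends (delConfig ends (cluster ends (delConfig ends {b} ω) a₂) ω) b a₁ := by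
      by_contra hc; exact hcon (Or.inr hc)
    obtain ⟨w, hw, hbw⟩ := hatt
    exact hQ (conn_symm (conn_trans (conn_trans (conn_mono (delConfig_singleton_le ends b ω) hw)
      (conn_symm (conn_of_openAdj hbw))) (conn_mono (delConfig_le _ ω) hc)))
  · rintro ⟨ha₁, hor⟩
    rcases hor with hno | hc
    · intro h
      have hb : Conn ends ω b a₂ := conn_of_not_avoidConn h (fun h' => ha₁ (conn_symm h'))
      obtain ⟨w, hw, hw'⟩ := exists_openAdj_of_conn hne (conn_symm hb)
      exact hno ⟨w, hw', hw⟩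
    · exact not_conn_of_not_conn_delConfig hne ha₁ (fun h => hc (conn_symm h))

end Comb
end RowC1

end Summit.Ventures.PercRepro2
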